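import Literature.MathematicalPhysics.QuantumFieldTheory.Balaban1983to89.B12Eq210Scaling

/-!
# `Balaban1983to89.B12Eq32Variable270` — T. Bałaban, *Renormalization group approach to lattice gauge field theories.
I*, Commun. Math. Phys. **109** (1987) 249–301 [Balaban1987RG1], p. 270 display (3.2): «Let us denote for simplicity
the expression under the exponential in {…} by B′, i.e., B′ = g_kCB − hD̃(g_kCB). (3.2)» — THE §3 VARIABLE AT PRINT'S
LETTERS `g_k`, `C`, `h`, `D̃`, as a definition with body over p07's (2.10) setting, with its two uses on pp. 267–268
read off by name: the constraint value `LQ̃(B′) + C̃(B′) = g_k·LQ̃(CB)` (the δ-function after the change of variables)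
and the bracket of (2.10) at `B′` (the exponent of (2.12))

statement-level skeleton of published theorems with citation tags; proofs where landed; nothing here is a claim about
the Yang–Mills mass gap

SOURCE (HELD): `paper:balaban1987-cmp109-rg-i-small-field` p. 270 [PDF 22] L21–23 (text layer `p0022.txt`; render
`b2b-balaban-ref1/pages/1987-cmp109-rg-I-small-field/…-p022-x2.png`), quoted above; p. 268 (2.12) [PDF 20] carries the
same expression inside `E_k(U_k(exp i[g_kCB − hD̃(g_kCB)]V^{(k)}))`; p. 267 [PDF 19]: «the transformation B′ = B − hD̃(B)
linearizes the function Q̃(B′) … Next we make the scaling transformation B = g_kB′»; p. 268 L1–2: «Denoting the remaining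
variables by B we have B′ = CB».

CITATION HEADER ∕ WHAT IS REPRODUCED.  SKELETON row **B12.Eq3.2** (kind D; display owner r09 = this seat; head
`typed-existing`, HEAD QUESTION B12-Q18 2026-08-23T16:33:45Z).  WHAT THE TREE HAD: p07's `B12Eq210Scaling.Setting`
(the (2.10) data incl. `h = D.hop`, `D̃ = Dt`) with `Setting.oldVar g B″ := g • B″ − hD̃(g • B″)` («the point at which the
bracket of (2.10) is evaluated after the change of variables B′ = B − hD̃(B) and the scaling B = g_kB′»),
`constraint_oldVar`, `bracket210_onConstraint_quad`; the elimination letter `C` of p. 268 as a matrix parameter (r20's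
`B12Eq213Body268.prec212 Cop`, `Beta.ConstraintElimination.elim`).  THIS FILE names print's instance: (3.2) IS
`oldVar g_k (C B)`.  Nothing of p07's file is re-proved.

WHAT THIS FILE PROVES (1 def with body + theorems; 0 `Prop` facts, 0 sorry; axioms standard).
* `bPrime32 S C g B := S.oldVar g (C *ᵥ B)` — (3.2); `bPrime32_eq` (the display verbatim: `= g • CB − hD̃(g • CB)`),
  `bPrime32_eq_oldVar`.
* `constraint_bPrime32` — at `B′` of (3.2) the constraint function of (2.10) is `LQ̃(B′) + C̃(B′) = g_k·LQ̃(CB)` (p07's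
  `constraint_oldVar`), hence `= 0` on the remaining variables when `CB` solves the linearised constraint
  (`constraint_bPrime32_eq_zero`: «using the δ-functions δ(Q̃B′) we eliminate … B′ = CB»).
* `bracket210_bPrime32` — the bracket of (2.10) evaluated at (3.2)'s `B′` on the constraint surface is
  `−g_k⁻²A(U_{k+1}) − ½⟨CB, Δ^{(k)}(CB)⟩ + g_k·rest + E_k(U_k(exp iB′ V^{(k)}))` — the exponent bookkeeping of (2.12) with the
  curly bracket's argument being exactly (3.2) (p07's `bracket210_onConstraint_quad`).

HONEST SCOPE.  Letters `h`, `D̃`, `C` are the abstract fields∕parameters of p07's setting and a matrix (their B12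
constructions: `B12HOperator267`, `B12SecondOrder267Concrete` ∕ `B12LinearizationGenuineZd`, `Beta.ConstraintElimination` on
other carriers); nothing analytic is asserted.  A naming display located; NOT summit progress.  Unit `lit-balaban-r09`
gen 44, HOME `run/shared/lean/pub/lit-balaban/`.
-/

namespace Literature.MathematicalPhysics.QuantumFieldTheory.Balaban1983to89.B12Eq32Variable270

noncomputable section

open Matrix
open scoped Matrix
open B12Eq210Scaling (Setting)

variable {q κ : Type*} [Fintype κ] {W X : Type*} [AddCommGroup W] [Module ℝ W] [AddCommGroup X]
  [Module ℝ X]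

/-- **(3.2)**: `B′ = g_kCB − hD̃(g_kCB)` — «the expression under the exponential in {…}» of (2.12), named `B′` for §3;
p07's `oldVar` at the remaining variables `B` through the elimination matrix `C` («B′ = CB», p. 268).
[cite: Balaban1987RG1, (3.2) p.270] -/
def bPrime32 (S : Setting ℝ (q → ℝ) W X) (C : Matrix q κ ℝ) (g : ℝ) (B : κ → ℝ) : q → ℝ :=
  S.oldVar g (C *ᵥ B)

variable (S : Setting ℝ (q → ℝ) W X) (C : Matrix q κ ℝ) (g : ℝ) (B : κ → ℝ)

/-- (3.2) verbatim: `B′ = g·CB − hD̃(g·CB)` (`h = S.D.hop`, `D̃ = S.Dt`). [cite: Balaban1987RG1, (3.2) p.270] -/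
theorem bPrime32_eq : bPrime32 S C g B = g • (C *ᵥ B) - S.D.hop (S.Dt (g • (C *ᵥ B))) := rfl

/-- (3.2) is p07's `oldVar` at `CB`. [cite: Balaban1987RG1, (3.2) p.270, (2.11) p.267] -/
theorem bPrime32_eq_oldVar : bPrime32 S C g B = S.oldVar g (C *ᵥ B) := rfl

/-- **The δ-function after the change of variables, at (3.2)**: `LQ̃(B′) + C̃(B′) = g·LQ̃(CB)` — p07's `constraint_oldVar`
(«the above change of variables yields the integral with the δ-function δ(Q̃B)», «B = g_kB′», «B′ = CB»), given `LQ̃h = 1`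
and the fixed-point equation of `D̃`. [cite: Balaban1987RG1, (3.2) p.270, (2.11) p.267] -/
theorem constraint_bPrime32 (LQ : (q → ℝ) →ₗ[ℝ] X) (Ct : (q → ℝ) → X) (hLQh : ∀ D' : X, LQ (S.D.hop D') = D')
    (hfix : ∀ B'' : q → ℝ, Ct (B'' - S.D.hop (S.Dt B'')) = S.Dt B'') :
    LQ (bPrime32 S C g B) + Ct (bPrime32 S C g B) = g • LQ (C *ᵥ B) :=
  S.constraint_oldVar LQ Ct hLQh hfix g (C *ᵥ B)

/-- … hence the constraint VANISHES at (3.2) whenever `CB` solves the linearised constraint `LQ̃(CB) = 0` — the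
remaining variables `B` parametrise `{Q̃B′ = 0}` («we eliminate the variables B′(b₀(c)) … B′ = CB»).
[cite: Balaban1987RG1, (3.2) p.270, (2.12) p.268] -/
theorem constraint_bPrime32_eq_zero (LQ : (q → ℝ) →ₗ[ℝ] X) (Ct : (q → ℝ) → X)
    (hLQh : ∀ D' : X, LQ (S.D.hop D') = D') (hfix : ∀ B'' : q → ℝ, Ct (B'' - S.D.hop (S.Dt B'')) = S.Dt B'')
    (hC : LQ (C *ᵥ B) = 0) : LQ (bPrime32 S C g B) + Ct (bPrime32 S C g B) = 0 := by
  rw [constraint_bPrime32 S C g B LQ Ct hLQh hfix, hC, smul_zero]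

/-- **The exponent of (2.12) with the curly bracket's argument being (3.2)**: on the constraint surface the bracket of
(2.10) at `B′ = g_kCB − hD̃(g_kCB)` is `−g_k⁻²A(U_{k+1}) − ½⟨CB, Δk·CB⟩ + g_k·rest + E_k(…B′…)` for any matrix `Δk`
representing the (1.5) form (p07's `bracket210_onConstraint_quad`; `Δk = Δ_k + G₂` at the [13] dictionary by
`B12Eq211Operator267`). [cite: Balaban1987RG1, (3.2) p.270, (2.12) p.268, (2.10)-(2.11) p.267] -/
theorem bracket210_bPrime32 [Fintype q] (Δk : Matrix q q ℝ) (hquad : ∀ B'' : q → ℝ, S.D.quad B'' = B'' ⬝ᵥ Δk *ᵥ B'') (hg : g ≠ 0)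
    (RD : (q → ℝ) → X) (RG : (q → ℝ) → ℝ) (RV : W → ℝ)
    (hDt : ∀ B'' : q → ℝ, S.Dt (g • B'') = g ^ 2 • S.D.Ctwo B'' + g ^ 3 • RD B'')
    (hG₃ : ∀ Y : q → ℝ, S.G₃ (g • Y) = g ^ 3 * RG Y) (hV : ∀ A' : W, S.Vpot (g • A') = g ^ 3 * RV A')
    (LQ : (q → ℝ) →ₗ[ℝ] X) (Qk : W →ₗ[ℝ] (q → ℝ)) (hQH : ∀ B'' : q → ℝ, Qk (S.D.H B'') = B'')
    (hJ : ∀ a' : W, LQ (Qk a') = 0 → S.D.pairJ a' = 0) (hC : LQ (C *ᵥ B) = 0) :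
    S.bracket210 g (bPrime32 S C g B) =
      -(1 / g ^ 2) * S.A - (1 / 2 : ℝ) * ((C *ᵥ B) ⬝ᵥ Δk *ᵥ (C *ᵥ B)) + g * S.rest g RD RG RV (C *ᵥ B)
        + S.Ek (bPrime32 S C g B) := by
  rw [bPrime32_eq_oldVar, S.bracket210_onConstraint_quad hg RD RG RV hDt hG₃ hV LQ Qk hQH hJ hC, hquad]

end

end Literature.MathematicalPhysics.QuantumFieldTheory.Balaban1983to89.B12Eq32Variable270
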